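import Summits.QuantumFields.GaugeBoot.TiltedBoxLimitPoints
import Summits.QuantumFields.GaugeBoot.TiltedBoxAxisFlips
import Summits.QuantumFields.GaugeBoot.TiltedBoxLinkRP
import Summits.QuantumFields.GaugeBoot.TiltedLatticeSymmetry
import Summits.QuantumFields.GaugeBoot.ClassBLimitLinkGeometry
import Summits.QuantumFields.GaugeBoot.ClassBLimitDiagonalGeometry
import HarnessLib

/-!
# Infinite-volume limit points of the 45°-tilted boxes, part 2: the lift intertwines the symmetries and the half-spaces

HONEST FRAMING (cell `pub-gaugeboot`, page 1 of every file): the venture produces certified bounds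
on lattice expectations at stated coupling, gauge group, dimension and torus size; NOT a mass gap,
NOT a continuum limit, NOT a string tension; NOT Yang–Mills-summit-bearing (barriers
`FixedCouplingUltralocality`, `PerturbativeInvisibility`). Pure bookkeeping for the transfer of the
tilted-box theorems to the limit points `tiltedBoxLimitPoints` (`TiltedBoxLimitPoints.lean`); no
claim is made here.

## Content

For the periodic lift `tiltedLift : Config (ℤ^d/Γ) d G → LGConfig d G` of `TiltedBoxLimitPoints.lean`:

* **intertwiners** — the lift carries the box symmetries of `TiltedLatticeSymmetry.lean`,
  `TiltedBox.lean`, `TiltedBoxSiteRP.lean`, `TiltedBoxAxisFlips.lean`, `TiltedBoxLinkRP.lean` to the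
  `ℤ^d` maps of `ClassB.lean` / `LatticeGaugeDLR.lean`:
  `tiltedLift (translate [a] U) = configShift (-a) (tiltedLift U)` (`tiltedLift_translate`),
  `tiltedLift (configSwap i j tiltedMirror U) = configDiagSwapZd i j (tiltedLift U)`
  (`tiltedLift_configSwap`),
  `tiltedLift (configReflect _ m (tiltedFlip m) U) = configSiteReflect m (tiltedLift U)`
  (`tiltedLift_configReflect_flip`; in particular for `tiltedReflect`, `m = k ∉ {i, j}`, and for the
  flips along `i`, `j` of the square box),
  `tiltedLift (configMidReflect _ k (tiltedReflect k) U) = configLinkReflect k (tiltedLift U)`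
  (`tiltedLift_configMidReflect`);
* **half-spaces** — a cylinder observable of `ℤ^d` supported on finitely many links of the closed
  half `diagHalfEdges i j` (resp. `siteHalfEdges k`, `linkHalfEdges k`, `k ∉ {i, j}`), read through
  the lift, is a closed-half observable of every sufficiently large box in the sense of the box
  theorems: `IsHalfObservable … M_v tiltedHeight` (`isHalfObservable_diag_comp_tiltedLift`),
  `IsHalfObservable … Q (tiltedCoord k)` (`isHalfObservable_site_comp_tiltedLift`),
  `IsMidObservable … Q (tiltedCoord k)` (`isMidObservable_link_comp_tiltedLift`).

References: J. Fröhlich, R. Israel, E. H. Lieb, B. Simon, J. Stat. Phys. 22 (1980) 297, §3;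
K. Osterwalder, E. Seiler, Ann. Phys. 110 (1978) 440, §2.
-/

noncomputable section

open MeasureTheory
open Literature.Probability.LatticeModels (Site)
open Literature.MathematicalPhysics.QuantumLattice

namespace Summit.QuantumFields.GaugeBoot

namespace TiltedRP

/-! ## Classes of translated sites -/

section Classes

variable (d : ℕ) (i j : Fin d) (Mu Mv L : ℕ)

/-- `[x + e_k] = [x] + tiltedUnit k`. -/
theorem mk_add_single (x : Site d) (k : Fin d) :
    ((x + Pi.single k (1 : ℤ) : Site d) : TiltedSite d i j Mu Mv L) =
      (x : TiltedSite d i j Mu Mv L) + tiltedUnit d i j Mu Mv L k := rfl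

/-- `[x - e_k] = [x] - tiltedUnit k`. -/
theorem mk_sub_single (x : Site d) (k : Fin d) :
    ((x - Pi.single k (1 : ℤ) : Site d) : TiltedSite d i j Mu Mv L) =
      (x : TiltedSite d i j Mu Mv L) - tiltedUnit d i j Mu Mv L k := rfl

/-- `[x + a] = [x] + [a]`. -/
theorem mk_add (x a : Site d) :
    ((x + a : Site d) : TiltedSite d i j Mu Mv L) =
      (x : TiltedSite d i j Mu Mv L) + (a : TiltedSite d i j Mu Mv L) := rfl

/-- The coordinate flip `negHom m` of `TiltedBoxSiteRP.lean` is the site reflection `zdSiteReflect m`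
of `ClassB.lean`. -/
theorem negHom_eq_zdSiteReflect (m : Fin d) (x : Site d) : negHom d m x = zdSiteReflect m x := by
  funext n
  simp only [negHom_apply, zdSiteReflect, Function.update_apply]
  by_cases h : n = m
  · subst h; simp
  · simp [h]

/-- `negHom m x + e_m` is the link reflection `zdLinkReflect m x`. -/
theorem negHom_add_single_eq_zdLinkReflect (m : Fin d) (x : Site d) :
    negHom d m x + Pi.single m (1 : ℤ) = zdLinkReflect m x := by
  funext n
  simp only [Pi.add_apply, negHom_apply, zdLinkReflect, Function.update_apply, Pi.single_apply]
  by_cases h : n = m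
  · subst h; simp only [if_true]; ring
  · simp [h]

/-- The coordinate swap `swapHom` of `TiltedBox.lean` is `zdDiagSwap` of `ClassB.lean`. -/
theorem swapHom_eq_zdDiagSwap (x : Site d) : swapHom d i j x = zdDiagSwap i j x := rfl

end Classes

/-! ## The lift intertwines the box symmetries with the `ℤ^d` maps -/

section Intertwiners

variable (d : ℕ) (i j : Fin d) (Mu Mv L : ℕ) {G : Type*}

/-- **Translations**: `tiltedLift (translate [a] U) = configShift (-a) (tiltedLift U)`. -/
theorem tiltedLift_translate [MeasurableSpace G] (a : Site d) (U : Config (TiltedSite d i j Mu Mv L) d G) :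
    tiltedLift d i j Mu Mv L (translate (a : TiltedSite d i j Mu Mv L) U) =
      configShift (-a) (tiltedLift d i j Mu Mv L U) := by
  funext e
  rw [configShift_apply, tiltedLift_apply, tiltedLift_apply, translate_apply, sub_neg_eq_add, mk_add]

/-- **The diagonal mirror**: `tiltedLift (configSwap i j tiltedMirror U) = configDiagSwapZd i j (tiltedLift U)`. -/
theorem tiltedLift_configSwap (U : Config (TiltedSite d i j Mu Mv L) d G) :
    tiltedLift d i j Mu Mv L (configSwap i j (tiltedMirror d i j Mu Mv L) U) =
      configDiagSwapZd i j (tiltedLift d i j Mu Mv L U) := by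
  funext e
  simp only [tiltedLift_apply, configSwap, configDiagSwapZd, linkSwap_mk, tiltedMirror_mk,
    swapHom_eq_zdDiagSwap]

variable [Group G]

/-- **Coordinate flips**: for every axis `m` along which `Γ` is flip invariant,
`tiltedLift (configReflect _ m (tiltedFlip m) U) = configSiteReflect m (tiltedLift U)`
(the flipped `m`-links are reversed and inverted on both sides). -/
theorem tiltedLift_configReflect_flip (m : Fin d)
    (hΓ : tiltedLattice d i j Mu Mv L ≤ (tiltedLattice d i j Mu Mv L).comap (negHom d m))
    (U : Config (TiltedSite d i j Mu Mv L) d G) :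
    tiltedLift d i j Mu Mv L (configReflect (tiltedUnit d i j Mu Mv L) m (tiltedFlip d Mu Mv L m hΓ) U) =
      configSiteReflect m (tiltedLift d i j Mu Mv L U) := by
  funext e
  obtain ⟨x, k⟩ := e
  simp only [tiltedLift_apply, configReflect, siteLinkMap, configSiteReflect_apply, tiltedFlip_mk,
    negHom_eq_zdSiteReflect]
  by_cases hk : k = m
  · subst hk
    simp only [if_true, ← sub_eq_add_neg, mk_sub_single]
  · simp only [if_neg hk, add_zero]

/-- **The coordinate reflection along `k ∉ {i, j}`** (`tiltedReflect` of `TiltedBoxSiteRP.lean`):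
`tiltedLift (configReflect _ k tiltedReflect U) = configSiteReflect k (tiltedLift U)`. -/
theorem tiltedLift_configReflect {k : Fin d} (hki : k ≠ i) (hkj : k ≠ j)
    (U : Config (TiltedSite d i j Mu Mv L) d G) :
    tiltedLift d i j Mu Mv L
        (configReflect (tiltedUnit d i j Mu Mv L) k (tiltedReflect d Mu Mv L hki hkj) U) =
      configSiteReflect k (tiltedLift d i j Mu Mv L U) :=
  tiltedLift_configReflect_flip d i j Mu Mv L k (tiltedLattice_le_comap_negHom d Mu Mv L hki hkj) U

/-- **The link (mid-plane) reflection along `k ∉ {i, j}`**: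
`tiltedLift (configMidReflect _ k tiltedReflect U) = configLinkReflect k (tiltedLift U)`. -/
theorem tiltedLift_configMidReflect {k : Fin d} (hki : k ≠ i) (hkj : k ≠ j)
    (U : Config (TiltedSite d i j Mu Mv L) d G) :
    tiltedLift d i j Mu Mv L
        (configMidReflect (tiltedUnit d i j Mu Mv L) k (tiltedReflect d Mu Mv L hki hkj) U) =
      configLinkReflect k (tiltedLift d i j Mu Mv L U) := by
  funext e
  obtain ⟨x, l⟩ := e
  have hmid : midReflect (tiltedUnit d i j Mu Mv L) k (tiltedReflect d Mu Mv L hki hkj)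
      (x : TiltedSite d i j Mu Mv L) = ((zdLinkReflect k x : Site d) : TiltedSite d i j Mu Mv L) := by
    rw [midReflect, tiltedReflect_mk, ← negHom_add_single_eq_zdLinkReflect, mk_add_single]
  simp only [tiltedLift_apply, configMidReflect, midLinkMap, configLinkReflect_apply, hmid]
  by_cases hl : l = k
  · subst hl
    simp only [if_true, ← sub_eq_add_neg, mk_sub_single]
  · simp only [if_neg hl, add_zero]

end Intertwiners

/-! ## Half-space cylinder observables lift to half observables of large boxes -/

section Halves

variable {d : ℕ} {i j : Fin d} {Mu Mv L : ℕ} {G α : Type*}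

/-- The height of the class of a site `x` with `0 ≤ x_i - x_j < 2M_v`, read in `[0, 2M_v)`, is
`x_i - x_j`. -/
theorem val_tiltedHeight_mk [NeZero Mv] {x : Site d} (h0 : 0 ≤ x i - x j) (hlt : x i - x j < 2 * Mv) :
    ((tiltedHeight d i j Mu Mv L (x : TiltedSite d i j Mu Mv L)).val : ℤ) = x i - x j := by
  haveI : NeZero (2 * Mv) := ⟨by have := NeZero.ne Mv; omega⟩
  rw [tiltedHeight_mk, ZMod.val_intCast]
  exact Int.emod_eq_of_lt h0 (by exact_mod_cast hlt)

/-- The coordinate `x_k mod L` of the class of a site with `0 ≤ x_k < L`, read in `[0, L)`, is `x_k`. -/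
theorem val_tiltedCoord_mk [NeZero L] {k : Fin d} (hki : k ≠ i) (hkj : k ≠ j) {x : Site d}
    (h0 : 0 ≤ x k) (hlt : x k < L) :
    ((tiltedCoord d Mu Mv L hki hkj (x : TiltedSite d i j Mu Mv L)).val : ℤ) = x k := by
  rw [tiltedCoord_mk, ZMod.val_intCast]
  exact Int.emod_eq_of_lt h0 hlt

/-- **Diagonal half.** A cylinder observable of `ℤ^d` supported on links `T` of the closed half
`{x_i ≥ x_j}` (`diagHalfEdges i j`) with `x_i - x_j ≤ m` on `T`, read through the lift, is an
observable of the closed half `{0 ≤ x_i - x_j ≤ M_v (mod 2M_v)}` of every box with `M_v ≥ m + 1`. -/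
theorem isHalfObservable_diag_comp_tiltedLift [NeZero Mv] {F : LGConfig d G → α}
    {T : Finset (ZdEdge d)} (hF : IsCylinder F T) (hT : ∀ e ∈ T, e ∈ diagHalfEdges i j) {m : ℕ}
    (hTm : ∀ e ∈ T, e.1 i - e.1 j ≤ m) (hMv : m + 1 ≤ Mv) :
    IsHalfObservable (tiltedUnit d i j Mu Mv L) Mv (tiltedHeight d i j Mu Mv L)
      (fun U => F (tiltedLift d i j Mu Mv L U)) := by
  intro U V hUV
  refine hF fun e he => ?_
  simp only [tiltedLift_apply]
  have hmem := hT e he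
  have hm := hTm e he
  refine hUV _ ⟨?_, ?_⟩
  · -- the source `[x]`
    show (tiltedHeight d i j Mu Mv L (e.1 : TiltedSite d i j Mu Mv L)).val ≤ Mv
    have h := val_tiltedHeight_mk (Mu := Mu) (L := L) (i := i) (j := j) (Mv := Mv) (x := e.1)
      (sub_nonneg.2 hmem.1) (by omega)
    omega
  · -- the target `[x] + e_k = [x + e_k]`
    show (tiltedHeight d i j Mu Mv L
      ((e.1 : TiltedSite d i j Mu Mv L) + tiltedUnit d i j Mu Mv L e.2)).val ≤ Mv
    rw [← mk_add_single]
    obtain ⟨h0, h1⟩ := diag_endpoint_bounds hmem hm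
    have h := val_tiltedHeight_mk (Mu := Mu) (L := L) (i := i) (j := j) (Mv := Mv) h0 (by omega)
    omega

/-- The coordinate `k` of the endpoint `x + e_l` of a link `(x, l)` with `0 ≤ x_k ≤ m` lies in
`[0, m + 1]`. -/
theorem coord_endpoint_bounds {k : Fin d} {e : ZdEdge d} (h0 : 0 ≤ e.1 k) {m : ℕ} (hm : e.1 k ≤ m) :
    0 ≤ (e.1 + Pi.single e.2 (1 : ℤ) : Site d) k ∧ (e.1 + Pi.single e.2 (1 : ℤ) : Site d) k ≤ m + 1 := by
  simp only [Pi.add_apply, Pi.single_apply]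
  split_ifs <;> constructor <;> omega

/-- **Site half along `k ∉ {i, j}`.** A cylinder observable supported on links `T` of the closed half
`{x_k ≥ 0}` (`siteHalfEdges k`) with `x_k ≤ m` on `T`, read through the lift, is an observable of the
closed half `{0 ≤ x_k ≤ Q (mod 2Q)}` of every box of transverse period `2Q` with `Q ≥ m + 1`. -/
theorem isHalfObservable_site_comp_tiltedLift {Q : ℕ} [NeZero Q] {k : Fin d} (hki : k ≠ i) (hkj : k ≠ j)
    {F : LGConfig d G → α} {T : Finset (ZdEdge d)} (hF : IsCylinder F T)
    (hT : ∀ e ∈ T, e ∈ siteHalfEdges k) {m : ℕ} (hTm : ∀ e ∈ T, e.1 k ≤ m) (hQ : m + 1 ≤ Q) :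
    IsHalfObservable (tiltedUnit d i j Mu Mv (2 * Q)) Q (tiltedCoord d Mu Mv (2 * Q) hki hkj)
      (fun U => F (tiltedLift d i j Mu Mv (2 * Q) U)) := by
  haveI : NeZero (2 * Q) := ⟨by have := NeZero.ne Q; omega⟩
  intro U V hUV
  refine hF fun e he => ?_
  simp only [tiltedLift_apply]
  have hmem : 0 ≤ e.1 k := hT e he
  have hm := hTm e he
  refine hUV _ ⟨?_, ?_⟩
  · show (tiltedCoord d Mu Mv (2 * Q) hki hkj (e.1 : TiltedSite d i j Mu Mv (2 * Q))).val ≤ Q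
    have h := val_tiltedCoord_mk (Mu := Mu) (Mv := Mv) (L := 2 * Q) hki hkj hmem
      (by push_cast; omega)
    omega
  · show (tiltedCoord d Mu Mv (2 * Q) hki hkj
      ((e.1 : TiltedSite d i j Mu Mv (2 * Q)) + tiltedUnit d i j Mu Mv (2 * Q) e.2)).val ≤ Q
    rw [← mk_add_single]
    obtain ⟨h0, h1⟩ := coord_endpoint_bounds hmem hm
    have h := val_tiltedCoord_mk (Mu := Mu) (Mv := Mv) (L := 2 * Q) (i := i) (j := j) hki hkj h0
      (by push_cast; omega)
    omega

/-- **Link half along `k ∉ {i, j}`.** A cylinder observable supported on links `T` of the closed half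
`{x_k ≥ 1}` (`linkHalfEdges k`) with `x_k ≤ m` on `T`, read through the lift, is an observable of the
closed half `{1 ≤ x_k ≤ Q (mod 2Q)}` of the mid-plane reflection of every box of transverse period
`2Q` with `Q ≥ m + 1`. -/
theorem isMidObservable_link_comp_tiltedLift {Q : ℕ} [NeZero Q] {k : Fin d} (hki : k ≠ i) (hkj : k ≠ j)
    {F : LGConfig d G → α} {T : Finset (ZdEdge d)} (hF : IsCylinder F T)
    (hT : ∀ e ∈ T, e ∈ linkHalfEdges k) {m : ℕ} (hTm : ∀ e ∈ T, e.1 k ≤ m) (hQ : m + 1 ≤ Q) :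
    IsMidObservable (tiltedUnit d i j Mu Mv (2 * Q)) Q (tiltedCoord d Mu Mv (2 * Q) hki hkj)
      (fun U => F (tiltedLift d i j Mu Mv (2 * Q) U)) := by
  haveI : NeZero (2 * Q) := ⟨by have := NeZero.ne Q; omega⟩
  intro U V hUV
  refine hF fun e he => ?_
  simp only [tiltedLift_apply]
  have hmem : 1 ≤ e.1 k := hT e he
  have hm := hTm e he
  refine hUV _ ⟨?_, ?_⟩
  · show 1 ≤ (tiltedCoord d Mu Mv (2 * Q) hki hkj (e.1 : TiltedSite d i j Mu Mv (2 * Q))).val ∧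
      (tiltedCoord d Mu Mv (2 * Q) hki hkj (e.1 : TiltedSite d i j Mu Mv (2 * Q))).val ≤ Q
    have h := val_tiltedCoord_mk (Mu := Mu) (Mv := Mv) (L := 2 * Q) hki hkj (x := e.1)
      (by omega) (by push_cast; omega)
    constructor <;> omega
  · show 1 ≤ (tiltedCoord d Mu Mv (2 * Q) hki hkj
        ((e.1 : TiltedSite d i j Mu Mv (2 * Q)) + tiltedUnit d i j Mu Mv (2 * Q) e.2)).val ∧
      (tiltedCoord d Mu Mv (2 * Q) hki hkj
        ((e.1 : TiltedSite d i j Mu Mv (2 * Q)) + tiltedUnit d i j Mu Mv (2 * Q) e.2)).val ≤ Q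
    rw [← mk_add_single]
    obtain ⟨h0, h1⟩ := coord_endpoint_bounds (k := k) (e := e) (by omega) hm
    have h1' : 1 ≤ (e.1 + Pi.single e.2 (1 : ℤ) : Site d) k := by
      simp only [Pi.add_apply, Pi.single_apply]
      split_ifs <;> omega
    have h := val_tiltedCoord_mk (Mu := Mu) (Mv := Mv) (L := 2 * Q) (i := i) (j := j) hki hkj h0
      (by push_cast; omega)
    constructor <;> omega

end Halves

end TiltedRP

end Summit.QuantumFields.GaugeBoot
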